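import Summits.KontsevichZagierPeriods.KontsevichZagierPeriods.Theorems.SoloInformedBandShear
import Summits.KontsevichZagierPeriods.KontsevichZagierPeriods.Theorems.SoloInformedStabilisation
import Literature.ModelTheory.ExponentialFields.CylindricalDecompositionProofs
import HarnessLib
import HarnessLib.Audit

/-!
# SoloInformed — GKZ^dens in degree `n` gives H3 in degree `n + 1` (PROPOSITION 5.1 of `planar-cauchy.md`)

Solo programme `solo-KontsevichZagierPeriods-informed`, session s248 (file 2 of 2; tools in `SoloInformedBandShear`).

**Theorem** (`soloInformed_h3At_succ_of_equidimInjAt`).  If the equidimensional kernel conjecture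
`GKZ^dens_n` (`SoloInformedEquidimInjAt n`: an `n`-dimensional formal combination with value `0`
lies in the subgroup `relations₁₂` generated by the additivity and change-of-variables moves in
dimension `n`) holds, then `H3_{n+1}` (`SoloInformedH3At (n + 1)`) holds: two `(n+1)`-dimensional
volume representations (integrand `≡ 1`) with the same volume are *scissors congruent*, i.e.
`[r] − [r'] ∈ 𝒮 = soloInformedScissorsRel` (generated by cutting along `ℚ`-semialgebraic sets up
to null sets and by volume-preserving `ℚ`-semialgebraic `C¹` maps).

**Proof.**  The key lemma `soloInformed_exists_equidim_density` writes every volume representation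
`r` of dimension `n + 1` as `sub y` modulo `𝒮` for an `n`-dimensional formal density `y` with
`eval y = vol r`: take a cylindrical decomposition adapted to `r.domain`; the non-open cells are
null; an open cell is a band `{f < t < g}` over an open cell `S` of the base (both sections are
finite because the cell has finite volume, `soloInformed_volume_bandOver_eq_top`); over the smooth
locus `G ⊆ S` of `f` (complement null, `exists_isOpen_contDiffOn`) the shear `t ↦ t − f(x)` is a
volume-preserving `ℚ`-semialgebraic `C¹` map onto the region under the graph of `g − f`
(`soloInformed_exists_shear_of_under`), which is `sub [G, g − f]` (`[G, g − f]` has integrand `≥ 0`).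
Given two volume representations with equal volumes, `y − y'` is an `n`-dimensional formal
combination with value `0`, so `GKZ^dens_n` puts it in `relations₁₂`, and the *density removal*
theorem `soloInformed_densityRemoval` (s247) gives `sub (y − y') ∈ 𝒮`; hence `[r] − [r'] ∈ 𝒮`.

**Corollaries.** `soloInformed_h3At_one` (`H3₁`, unconditional, from `GKZ^dens_0`);
`soloInformed_h3At_succ_of_summit_of_stab` (`KZP ∧ STAB ⟹ H3_{n+1}` for all `n`).  Together with
`soloInformed_summit_iff_stableH3` (s247) this closes the circle
`KZP ∧ STAB ⟺ GKZ^dens ⟹ (∀ n, H3_{n+1}) ⟹ H3^st`, `KZP ⟺ H3^st`.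

Bearing on the verdict (HOME `paper/VERDICT.md`): NO PATH is unchanged; this file makes the
generalized Hilbert-third-problem statements `H3_n` *consequences* of the summit-plus-stabilisation,
so that `H3₂` (planar scissors congruence with algebraic Jacobian-1 maps) is the first concrete test
of `GKZ^dens₁`, cf. `planar-cauchy.md` §§2–5.
-/

noncomputable section

open scoped BigOperators Topology ContDiff

namespace Summit.KontsevichZagierPeriods.KontsevichZagierPeriods.Theorems

open Set MeasureTheory Filter
open Literature.ModelTheory.ExponentialFields
open Literature.NumberTheory.Transcendental Literature.NumberTheory.Transcendental.KZ

variable {n : ℕ}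

/-! ### An open band is the region under a graph, modulo `𝒮` -/

/-- **Per-cell density.** A volume representation `A` whose domain is an open band
`{x ∈ S, f x < t < g x}` (`f ≤ g` `ℚ`-semialgebraic on `S`) is scissors congruent to `U(c)` for the
density `c = [G, g − f]`, `G ⊆ S` the smooth locus of `f`: `[A] − [U(c)] ∈ 𝒮`, and `c` has
integrand `≥ 0`. [this work] -/
theorem soloInformed_exists_density_of_band {S : Set (Fin n → ℝ)} (hS : IsSemialgebraic ℚ S)
    {f g : (Fin n → ℝ) → ℝ} (hf : IsSemialgebraicFunOn ℚ S f) (hg : IsSemialgebraicFunOn ℚ S g)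
    (hfg : ∀ x ∈ S, f x ≤ g x) {A : IntegralRep (n + 1)} (hA : SoloInformedIsVolRep A)
    (hAdom : ∀ z, z ∈ A.domain ↔
      Fin.init z ∈ S ∧ f (Fin.init z) < z (Fin.last n) ∧ z (Fin.last n) < g (Fin.init z)) :
    ∃ c : IntegralRep n, (∀ x ∈ c.domain, 0 ≤ c.integrand x) ∧
      of A - of (soloInformedUnder c) ∈ soloInformedScissorsRel := by
  have hAfin : volume A.domain < ⊤ := soloInformed_volume_domain_lt_top_of_isVolRep hA
  -- the smooth locus of `f`
  obtain ⟨G, hGS, hGo, hGsa, hfsm, hSGsa, hSGnull⟩ := exists_isOpen_contDiffOn hS hf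
  have hGm : MeasurableSet G := hGo.measurableSet
  have hfG : IsSemialgebraicFunOn ℚ G f := hf.mono hGS hGsa
  have hgG : IsSemialgebraicFunOn ℚ G g := hg.mono hGS hGsa
  have hqG : IsSemialgebraicFunOn ℚ G (fun x => g x - f x) := IsSemialgebraicFunOn.sub_holds hgG hfG
  -- the open band over `G`, and its volume by Tonelli
  set Bo : Set (Fin (n + 1) → ℝ) := A.domain ∩ {z : Fin (n + 1) → ℝ | Fin.init z ∈ G} with hBo_def
  have hBo_mem : ∀ z, z ∈ Bo ↔ Fin.init z ∈ G ∧ f (Fin.init z) < z (Fin.last n) ∧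
      z (Fin.last n) < g (Fin.init z) := fun z => by
    rw [hBo_def, mem_inter_iff, hAdom, mem_setOf_eq]
    constructor
    · rintro ⟨⟨-, h1, h2⟩, hG⟩
      exact ⟨hG, h1, h2⟩
    · rintro ⟨hG, h1, h2⟩
      exact ⟨⟨hGS hG, h1, h2⟩, hG⟩
  have hBosa : IsSemialgebraic ℚ Bo := A.isSemialgebraic_domain.inter hGsa.setOf_init_mem
  have hBom : MeasurableSet Bo := IsSemialgebraic.measurableSet_holds hBosa
  have hBovol : volume Bo = ∫⁻ x in G, ENNReal.ofReal (g x - f x) := by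
    set e : (Fin (n + 1) → ℝ) ≃ᵐ ℝ × (Fin n → ℝ) :=
      MeasurableEquiv.piFinSuccAbove (fun _ => ℝ) (Fin.last n) with he_def
    have he : MeasurePreserving e volume volume :=
      volume_preserving_piFinSuccAbove (fun _ => ℝ) (Fin.last n)
    have he_symm : ∀ p : ℝ × (Fin n → ℝ), e.symm p = Fin.snoc p.2 p.1 := fun p => by
      simp [he_def, MeasurableEquiv.piFinSuccAbove, Fin.snocEquiv]
    have hS' : MeasurableSet (e.symm ⁻¹' Bo) := e.symm.measurable hBom
    calc volume Bo = volume (e.symm ⁻¹' Bo) :=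
          ((he.symm e).measure_preimage hBom.nullMeasurableSet).symm
      _ = (volume : Measure ℝ).prod (volume : Measure (Fin n → ℝ)) (e.symm ⁻¹' Bo) := by
          rw [Measure.volume_eq_prod]
      _ = ∫⁻ y, volume ((fun t : ℝ => (t, y)) ⁻¹' (e.symm ⁻¹' Bo)) := Measure.prod_apply_symm hS'
      _ = ∫⁻ y, G.indicator (fun y => ENNReal.ofReal (g y - f y)) y := by
          refine lintegral_congr fun y => ?_
          by_cases hy : y ∈ G
          · have : (fun t : ℝ => (t, y)) ⁻¹' (e.symm ⁻¹' Bo) = Ioo (f y) (g y) := by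
              ext t
              simp only [mem_preimage, he_symm, hBo_mem, Fin.init_snoc, Fin.snoc_last, mem_Ioo]
              exact ⟨fun h => ⟨h.2.1, h.2.2⟩, fun h => ⟨hy, h.1, h.2⟩⟩
            rw [this, Real.volume_Ioo, indicator_of_mem hy]
          · have : (fun t : ℝ => (t, y)) ⁻¹' (e.symm ⁻¹' Bo) = ∅ := by
              ext t
              simp only [mem_preimage, he_symm, hBo_mem, Fin.init_snoc, Fin.snoc_last,
                mem_empty_iff_false, iff_false, not_and]
              exact fun h => absurd h hy
            rw [this, measure_empty, indicator_of_notMem hy]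
      _ = ∫⁻ y in G, ENNReal.ofReal (g y - f y) := lintegral_indicator hGm _
  have hBofin : volume Bo < ⊤ := lt_of_le_of_lt (measure_mono inter_subset_left) hAfin
  -- the density representation `c = [G, g − f]`
  have hint : IntegrableOn (fun x => g x - f x) G volume := by
    refine ⟨aestronglyMeasurable_of_isSemialgebraicFunOn hqG hGm, ?_⟩
    rw [hasFiniteIntegral_iff_enorm]
    have : ∫⁻ x in G, ‖g x - f x‖ₑ = ∫⁻ x in G, ENNReal.ofReal (g x - f x) :=
      setLIntegral_congr_fun hGm fun x hx => by
        rw [Real.enorm_eq_ofReal (sub_nonneg.2 (hfg x (hGS hx)))]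
    rw [this, ← hBovol]
    exact hBofin
  set c : IntegralRep n := ⟨G, fun x => g x - f x, hGsa, hqG, hint⟩ with hc_def
  have hc0 : ∀ x ∈ c.domain, 0 ≤ c.integrand x := fun x hx => sub_nonneg.2 (hfg x (hGS hx))
  -- the shear of `U(c)` onto the closed band over `G`
  obtain ⟨M, hMvol, hMdom, hmap⟩ := soloInformed_exists_shear_of_under c (f := f)
    (f' := fun x => fderiv ℝ f x) hfG (fun x hx => soloInformed_hasFDerivAt_of_contDiffOn' hGo hfsm hx)
  -- the common part `R = Bo ∩ M.domain`, restricted from `A` and from `M`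
  have hRsa : IsSemialgebraic ℚ (Bo ∩ M.domain) := hBosa.inter M.isSemialgebraic_domain
  set R : IntegralRep (n + 1) := soloInformedRestrict A hRsa (fun z hz => hz.1.1) with hR_def
  set R' : IntegralRep (n + 1) := soloInformedRestrict M hRsa (fun z hz => hz.2) with hR'_def
  have hRvol : SoloInformedIsVolRep R := fun z hz => hA z hz.1.1
  have hR'vol : SoloInformedIsVolRep R' := fun z hz => hMvol z hz.2
  -- `A ∖ R` lies in the cylinder over the null set `S ∖ G`
  have h1 : of A - of R ∈ soloInformedScissorsRel := by
    refine soloInformed_of_sub_of_mem_scissorsRel_of_subset hA hRvol (fun z hz => hz.1.1) ?_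
    refine measure_mono_null (fun z hz => ?_) (volume_setOf_init_mem_eq_zero hSGnull)
    obtain ⟨hzA, hzR⟩ := hz
    obtain ⟨hzS, hz1, hz2⟩ := (hAdom z).1 hzA
    refine ⟨hzS, fun hzG => hzR ⟨⟨hzA, hzG⟩, ?_⟩⟩
    rw [hMdom]
    refine ⟨hzG, hz1.le, ?_⟩
    show z (Fin.last n) ≤ f (Fin.init z) + (g (Fin.init z) - f (Fin.init z))
    linarith
  -- `M ∖ R'` lies in the graphs of `f` and `g` over `G`
  have h2 : of M - of R' ∈ soloInformedScissorsRel := by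
    refine soloInformed_of_sub_of_mem_scissorsRel_of_subset hMvol hR'vol (fun z hz => hz.2) ?_
    refine measure_mono_null (fun z hz => ?_)
      (measure_union_null (volume_graph_eq_zero hfG) (volume_graph_eq_zero hgG))
    obtain ⟨hzM, hzR⟩ := hz
    have hzM' := hzM
    rw [hMdom] at hzM'
    obtain ⟨hzG, hz1, hz2⟩ := hzM'
    have hz2' : z (Fin.last n) ≤ g (Fin.init z) := by
      change _ ≤ f (Fin.init z) + (g (Fin.init z) - f (Fin.init z)) at hz2
      linarith
    have hnot : ¬ (f (Fin.init z) < z (Fin.last n) ∧ z (Fin.last n) < g (Fin.init z)) := fun h =>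
      hzR ⟨(hBo_mem z).2 ⟨hzG, h.1, h.2⟩, hzM⟩
    by_cases heq : z (Fin.last n) = f (Fin.init z)
    · exact Or.inl ⟨hzG, heq⟩
    · right
      have hlt : f (Fin.init z) < z (Fin.last n) := lt_of_le_of_ne hz1 (Ne.symm heq)
      exact ⟨hzG, le_antisymm hz2' (not_lt.1 fun h => hnot ⟨hlt, h⟩)⟩
  have h3 : of R - of R' ∈ soloInformedScissorsRel :=
    soloInformed_of_sub_of_mem_scissorsRel_of_domain_eq hRvol hR'vol rfl
  have h4 : of (soloInformedUnder c) - of M ∈ soloInformedScissorsRel :=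
    soloInformed_mapGen_subset_scissorsRel hmap
  refine ⟨c, hc0, ?_⟩
  have e : of A - of (soloInformedUnder c) =
      (of A - of R) + (of R - of R') - (of M - of R') - (of (soloInformedUnder c) - of M) := by
    abel
  rw [e]
  exact sub_mem (sub_mem (add_mem h1 h3) h2) h4

/-! ### Every volume representation is `sub` of an equidimensional density, modulo `𝒮` -/

/-- **Key lemma.** Every `(n+1)`-dimensional volume representation `r` is scissors congruent to
`sub y` for an `n`-dimensional formal combination `y` (`π_n y = y`) with `eval y = vol r`:
`[r] − sub y ∈ 𝒮`. (CAD adapted to `r.domain`; open cells are bands between finite sections;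
shear each onto the region under the graph of the difference of its sections.) [this work] -/
theorem soloInformed_exists_equidim_density (r : IntegralRep (n + 1)) (hr : SoloInformedIsVolRep r) :
    ∃ y : FormalRep, soloInformedDimProj n y = y ∧ eval y = r.value ∧
      of r - soloInformedSub y ∈ soloInformedScissorsRel := by
  classical
  have hrfin : volume r.domain < ⊤ := soloInformed_volume_domain_lt_top_of_isVolRep hr
  obtain ⟨𝒯, h𝒯, h𝒞⟩ := IsSemialgebraic.exists_cylindricalDecomposition_holds (k := ℚ)
    ({r.domain} : Finset (Set (Fin (n + 1) → ℝ))) (fun s hs => by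
      rw [Finset.mem_singleton] at hs
      rw [hs]
      exact r.isSemialgebraic_domain)
  obtain ⟨𝒞, h𝒞𝒯, hcover⟩ := h𝒞 r.domain (Finset.mem_singleton_self _)
  obtain ⟨𝒮, h𝒮, l, ξ, hcont, hsa, hmono, hmem⟩ := h𝒯.exists_isCylinderStack
  have hsplit := soloInformed_of_sub_sum_openCells_mem_scissorsRel h𝒯 hr h𝒞𝒯 hcover
  -- each open cell is an open band between two finite sections over an open base cell
  have hcell : ∀ C ∈ 𝒞.filter IsOpen, ∃ c : IntegralRep n, (∀ x ∈ c.domain, 0 ≤ c.integrand x) ∧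
      of (soloInformedCadRep r C) - of (soloInformedUnder c) ∈ soloInformedScissorsRel := by
    intro C hC
    rw [Finset.mem_filter] at hC
    obtain ⟨hC𝒞, hCo⟩ := hC
    have hCsub : C ⊆ r.domain := hcover ▸ subset_sUnion_of_mem hC𝒞
    have hCsa : IsSemialgebraic ℚ C := h𝒯.isSemialgebraic C (h𝒞𝒯 hC𝒞)
    obtain ⟨S, hS𝒮, hSo, j, hCj⟩ :=
      soloInformed_exists_bandOver_of_isOpen h𝒯 h𝒮 hsa hmem (h𝒞𝒯 hC𝒞) hCo
    have hSsa : IsSemialgebraic ℚ S := h𝒮.isSemialgebraic S hS𝒮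
    have hSne : S.Nonempty := nonempty_iff_ne_empty.2 fun h => h𝒮.isPartition.1 (h ▸ hS𝒮)
    have hCfin : volume C ≠ ⊤ := (lt_of_le_of_lt (measure_mono hCsub) hrfin).ne
    have hj0 : j ≠ 0 := fun h =>
      hCfin (hCj ▸ soloInformed_volume_bandOver_eq_top hSo hSne (hcont S hS𝒮) (Or.inl h))
    have hjl : j ≠ Fin.last (l S) := fun h =>
      hCfin (hCj ▸ soloInformed_volume_bandOver_eq_top hSo hSne (hcont S hS𝒮) (Or.inr h))
    have hfg : ∀ x ∈ S, ξ S (j.pred hj0) x ≤ ξ S (j.castPred hjl) x := fun x hx => by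
      refine (hmono S hS𝒮 x hx).monotone ?_
      rw [Fin.le_iff_val_le_val, Fin.val_pred, Fin.coe_castPred]
      omega
    have hA : SoloInformedIsVolRep (soloInformedCadRep r C) := fun x hx => by
      rw [soloInformed_cadRep_integrand]
      rw [soloInformed_cadRep_domain r hCsa hCsub] at hx
      exact hr x (hCsub hx)
    refine soloInformed_exists_density_of_band hSsa (hsa S hS𝒮 _) (hsa S hS𝒮 _) hfg hA fun z => ?_
    rw [soloInformed_cadRep_domain r hCsa hCsub, hCj, mem_bandOver_iff, bandLower_of_ne_zero _ j hj0,
      bandUpper_of_ne_last _ j hjl, EReal.coe_lt_coe_iff, EReal.coe_lt_coe_iff]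
  choose c hc0 hcS using hcell
  refine ⟨∑ C ∈ (𝒞.filter IsOpen).attach, of (c C.1 C.2), ?_, ?_, ?_⟩
  · rw [map_sum]
    exact Finset.sum_congr rfl fun C _ => soloInformed_dimProj_of_self _
  · -- values: `eval [c_C] = ∫ (g − f) = vol U(c_C) = vol C`, and `∑ vol C = vol r`
    have hval : ∀ C (hC : C ∈ 𝒞.filter IsOpen),
        eval (of (c C hC)) = (soloInformedCadRep r C).value := by
      intro C hC
      rw [eval_of, ← soloInformed_value_under_of_nonneg (c C hC) (hc0 C hC)]
      have h := soloInformed_eval_eq_zero_of_mem_scissorsRel (hcS C hC)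
      rw [map_sub, eval_of, eval_of, sub_eq_zero] at h
      exact h.symm
    rw [map_sum, Finset.sum_congr rfl fun C _ => hval C.1 C.2,
      Finset.sum_attach (𝒞.filter IsOpen) (fun C => (soloInformedCadRep r C).value)]
    have h := soloInformed_eval_eq_zero_of_mem_scissorsRel hsplit
    rw [map_sub, map_sum, eval_of, sub_eq_zero] at h
    simp only [eval_of] at h
    exact h.symm
  · have hterm : ∀ C (hC : C ∈ 𝒞.filter IsOpen),
        of (soloInformedCadRep r C) - soloInformedSub (of (c C hC)) ∈ soloInformedScissorsRel := by
      intro C hC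
      rw [soloInformed_sub_of]
      have hneg : of (soloInformedUnder (c C hC).neg) ∈ soloInformedScissorsRel :=
        soloInformed_of_under_mem_scissorsRel_of_nonpos _ fun x hx => by
          rw [IntegralRep.integrand_neg, Pi.neg_apply, neg_nonpos]
          exact hc0 C hC x (by rwa [IntegralRep.domain_neg] at hx)
      have e : of (soloInformedCadRep r C) -
          (of (soloInformedUnder (c C hC)) - of (soloInformedUnder (c C hC).neg)) =
          (of (soloInformedCadRep r C) - of (soloInformedUnder (c C hC))) +
            of (soloInformedUnder (c C hC).neg) := by abel
      rw [e]
      exact add_mem (hcS C hC) hneg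
    have e : of r - soloInformedSub (∑ C ∈ (𝒞.filter IsOpen).attach, of (c C.1 C.2)) =
        (of r - ∑ C ∈ 𝒞.filter IsOpen, of (soloInformedCadRep r C)) +
          ∑ C ∈ (𝒞.filter IsOpen).attach,
            (of (soloInformedCadRep r C.1) - soloInformedSub (of (c C.1 C.2))) := by
      rw [map_sum, Finset.sum_sub_distrib,
        Finset.sum_attach (𝒞.filter IsOpen) (fun C => of (soloInformedCadRep r C))]
      abel
    rw [e]
    exact add_mem hsplit (AddSubgroup.sum_mem _ fun C _ => hterm C.1 C.2)

/-! ### GKZ^dens_n ⟹ H3_{n+1} -/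

/-- **PROPOSITION 5.1** (`planar-cauchy.md`): the equidimensional kernel conjecture in degree `n`
implies the generalized Hilbert third problem `H3_{n+1}`: volume representations of dimension
`n + 1` with equal volumes are scissors congruent. [this work] -/
theorem soloInformed_h3At_succ_of_equidimInjAt (h : SoloInformedEquidimInjAt n) :
    SoloInformedH3At (n + 1) := by
  intro r r' hr hr' hv
  obtain ⟨y, hy1, hy2, hy3⟩ := soloInformed_exists_equidim_density r hr
  obtain ⟨y', hy1', hy2', hy3'⟩ := soloInformed_exists_equidim_density r' hr'
  have hd : y - y' ∈ soloInformedEquidimRelations :=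
    h (y - y') (by rw [map_sub, hy1, hy1']) (by rw [map_sub, hy2, hy2', hv, sub_self])
  have hS : soloInformedSub (y - y') ∈ soloInformedScissorsRel := soloInformed_densityRemoval _ hd
  have e : of r - of r' = (of r - soloInformedSub y) - (of r' - soloInformedSub y') +
      soloInformedSub (y - y') := by
    rw [map_sub]
    abel
  rw [e]
  exact add_mem (sub_mem hy3 hy3') hS

/-- `GKZ^dens ⟹ H3_{n+1}` for every `n`. [this work] -/
theorem soloInformed_h3At_succ_of_equidimInj (h : SoloInformedEquidimInj) (n : ℕ) :
    SoloInformedH3At (n + 1) :=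
  soloInformed_h3At_succ_of_equidimInjAt (h n)

/-- **`H3₁` holds unconditionally**: one-dimensional volume representations (finite unions of
intervals with real-algebraic endpoints) of equal length are scissors congruent — from
`GKZ^dens_0` (`soloInformed_equidimInjAt_zero`). [this work] -/
theorem soloInformed_h3At_one : SoloInformedH3At 1 :=
  soloInformed_h3At_succ_of_equidimInjAt soloInformed_equidimInjAt_zero

/-- **`KZP ∧ STAB ⟹ H3_{n+1}`** for every `n` (via `soloInformed_equidimInj_iff`). [this work] -/
theorem soloInformed_h3At_succ_of_summit_of_stab (hK : KontsevichZagierPeriods)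
    (hS : SoloInformedStab) (n : ℕ) : SoloInformedH3At (n + 1) :=
  soloInformed_h3At_succ_of_equidimInj (soloInformed_equidimInj_iff.2 ⟨hK, hS⟩) n

end Summit.KontsevichZagierPeriods.KontsevichZagierPeriods.Theorems

end
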